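import Literature.Geometry.Lorentzian.SchoenYauHeightBound
import Literature.Geometry.Lorentzian.AsymptoticallyFlatCompleteness
import HarnessLib

/-!
# Schoen–Yau 1979, pp. 57–58: `(r')²` is subharmonic on a minimal surface far out on an end

Schoen–Yau, Comm. Math. Phys. 65 (1979), §2, second proof of the Claim `∫_S K ≤ 0`, pp. 57–58:
for `x ∈ ℝ³` let `x' = (x¹, x², 0)` and `r' = |x'|`. *"We claim that `(r')²` is a subharmonic
function on `S` for `r'` sufficiently large … We calculate
`Δ(r')² = Σᵢ ∇_{eᵢ eᵢ}(r')² = Σᵢ D_{eᵢ eᵢ}(r')² + Σᵢ hᵢᵢ ν((r')²) = Σᵢ D_{eᵢ eᵢ}(r')²` since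
`Σ hᵢᵢ = 0`. Thus we have `Δ(r')² = 2 Σᵢ Σ_{j ≤ 2} ⟨eᵢ, ∂ⱼ⟩² + O(1/r)` … Since both `{e₁, e₂}`
and `{∂₁, ∂₂}` span 2-dimensional subspaces of `ℝ³`, they must intersect in at least a line, so
the norm of their projection is asymptotically bounded below … So we have
`Δ(r')² ≥ 2 − O(1/r)` as `r → ∞`. Thus for `r` sufficiently large, in particular for `r'`
sufficiently large we have `Δ(r')² > 0`."*

We prove this for an arbitrary unit axis `u` (`(r')² = |x|² − ⟨u, x⟩²`, printed `u = e₃`) and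
an arbitrary spacelike immersed surface with `H ≡ 0` in a `3`-dimensional initial data set, far
out on an end with `IsAsymptoticallySchwarzschild e D M 2` (any `M`):

* `AFEnd.eventually_abs_hessAt_hCoeff_cylSq_sub_le` — the chart estimate
  `|Hess_G (|y|² − ⟨u,y⟩²)(X, X) − (2‖X‖² − 2⟨u,X⟩²)| ≤ C |y|⁻¹ ‖X‖²` (`D²` of the quadratic
  function is `2(δ − u ⊗ u)`; the Christoffel term is `O(1/r)`).
* `sum_sq_inner_le_of_near_orthonormal` — the linear algebra *"two 2-planes of `ℝ³` meet in a
  line"* in quantitative form: for nearly orthonormal `X₁, X₂` and any `u`,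
  `⟨u,X₁⟩² + ⟨u,X₂⟩² ≤ (1 + 2η)‖u‖²` (Bessel's inequality up to `η`).
* `AFEnd.hessian_cylSq_frame_pos_of_mem` — for `q` far out and `w₁, w₂ ∈ T_q X` orthonormal
  for `h`, `Hess_h (r')²(w₁,w₁) + Hess_h (r')²(w₂,w₂) > 0`.
* `SchoenYau.dalembertian_cylSq_pos`, `SchoenYau.not_isLocalMax_cylSq` — **`Δ_S (r')² > 0` far
  out** on a spacelike immersed surface with `H ≡ 0` (`dalembertian_comp_eq`), hence no interior
  local maximum of `(r')²|_S` there (`dalembertian_nonpos_of_isLocalMax`).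

Everything is proved; no named fact and no `sorry` is introduced.

## References

* R. Schoen, S.-T. Yau, *On the proof of the positive mass conjecture in general relativity*,
  Comm. Math. Phys. 65 (1979), 45–76, §2, pp. 57–58. [SchoenYauPMT1979]
-/

noncomputable section

set_option maxSynthPendingDepth 3

open Bundle Set Function Filter Asymptotics Bornology Metric ContinuousLinearMap
open scoped Manifold ContDiff Topology RealInnerProductSpace

namespace Literature.Geometry.Lorentzian

open MetricCoord

/-! ### Linear algebra: Bessel's inequality for a nearly orthonormal pair -/

section Bessel

variable {E : Type*} [NormedAddCommGroup E] [InnerProductSpace ℝ E]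

/-- **Bessel's inequality for a nearly orthonormal pair**: if `|‖X₁‖² − 1|, |‖X₂‖² − 1| ≤ η` and
`|⟨X₁, X₂⟩| ≤ η` (`η ≥ 0`), then `⟨u, X₁⟩² + ⟨u, X₂⟩² ≤ (1 + 2η) ‖u‖²` for every `u`. With
`s = Σ cₐ²`, `cₐ = ⟨u, Xₐ⟩`, `V = Σ cₐ Xₐ`: `s = ⟨u, V⟩ ≤ ‖u‖‖V‖` and `‖V‖² ≤ (1 + 2η) s`. This
is the quantitative form of Schoen–Yau's remark that two `2`-planes of `ℝ³` meet in a line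
(p. 58: "the norm of their projection is asymptotically bounded below"). [folklore] -/
theorem sum_sq_inner_le_of_near_orthonormal {η : ℝ} (hη : 0 ≤ η) {X₁ X₂ : E}
    (h₁ : |‖X₁‖ ^ 2 - 1| ≤ η) (h₂ : |‖X₂‖ ^ 2 - 1| ≤ η) (h₁₂ : |⟪X₁, X₂⟫| ≤ η) (u : E) :
    ⟪u, X₁⟫ ^ 2 + ⟪u, X₂⟫ ^ 2 ≤ (1 + 2 * η) * ‖u‖ ^ 2 := by
  set c₁ := ⟪u, X₁⟫ with hc₁
  set c₂ := ⟪u, X₂⟫ with hc₂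
  set s := c₁ ^ 2 + c₂ ^ 2 with hs
  set V : E := c₁ • X₁ + c₂ • X₂ with hV
  have hs0 : 0 ≤ s := by positivity
  have hsV : s = ⟪u, V⟫ := by
    simp only [hV, inner_add_right, inner_smul_right, hs, ← hc₁, ← hc₂]; ring
  have hV2 : ‖V‖ ^ 2 ≤ (1 + 2 * η) * s := by
    have hexp : ‖V‖ ^ 2 = c₁ ^ 2 * ‖X₁‖ ^ 2 + 2 * (c₁ * c₂) * ⟪X₁, X₂⟫ + c₂ ^ 2 * ‖X₂‖ ^ 2 := by
      rw [hV, ← real_inner_self_eq_norm_sq]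
      simp only [inner_add_left, inner_add_right, inner_smul_left, inner_smul_right,
        real_inner_self_eq_norm_sq, real_inner_comm X₁ X₂, RCLike.conj_to_real]
      ring
    have hX₁ : ‖X₁‖ ^ 2 ≤ 1 + η := by linarith [(abs_le.1 h₁).2]
    have hX₂ : ‖X₂‖ ^ 2 ≤ 1 + η := by linarith [(abs_le.1 h₂).2]
    have hcross : 2 * (c₁ * c₂) * ⟪X₁, X₂⟫ ≤ (c₁ ^ 2 + c₂ ^ 2) * η := by
      have h1 : 2 * (c₁ * c₂) * ⟪X₁, X₂⟫ ≤ |2 * (c₁ * c₂)| * |⟪X₁, X₂⟫| := by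
        rw [← abs_mul]; exact le_abs_self _
      have h2 : |2 * (c₁ * c₂)| ≤ c₁ ^ 2 + c₂ ^ 2 := by
        rw [abs_le]; constructor <;> nlinarith [sq_nonneg (c₁ + c₂), sq_nonneg (c₁ - c₂)]
      calc 2 * (c₁ * c₂) * ⟪X₁, X₂⟫ ≤ |2 * (c₁ * c₂)| * |⟪X₁, X₂⟫| := h1
        _ ≤ (c₁ ^ 2 + c₂ ^ 2) * η :=
            mul_le_mul h2 h₁₂ (abs_nonneg _) (by positivity)
    rw [hexp, hs]
    have e1 : c₁ ^ 2 * ‖X₁‖ ^ 2 ≤ c₁ ^ 2 * (1 + η) := mul_le_mul_of_nonneg_left hX₁ (sq_nonneg _)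
    have e2 : c₂ ^ 2 * ‖X₂‖ ^ 2 ≤ c₂ ^ 2 * (1 + η) := mul_le_mul_of_nonneg_left hX₂ (sq_nonneg _)
    nlinarith
  -- `s² = ⟨u, V⟩² ≤ ‖u‖² ‖V‖² ≤ ‖u‖² (1 + 2η) s`
  have hCS : s ^ 2 ≤ ‖u‖ ^ 2 * ‖V‖ ^ 2 := by
    rw [hsV, ← mul_pow]
    exact pow_le_pow_left₀ (hsV ▸ hs0) (real_inner_le_norm _ _) 2
  have hkey : s ^ 2 ≤ ‖u‖ ^ 2 * ((1 + 2 * η) * s) :=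
    hCS.trans (mul_le_mul_of_nonneg_left hV2 (sq_nonneg _))
  by_cases hs' : s = 0
  · rw [hs'] ; positivity
  · have hspos : 0 < s := lt_of_le_of_ne hs0 (Ne.symm hs')
    have : s * s ≤ ((1 + 2 * η) * ‖u‖ ^ 2) * s := by nlinarith
    exact le_of_mul_le_mul_right this hspos

end Bessel

/-! ### The chart estimate for `|y|² − ⟨u, y⟩²` -/

namespace AFEnd

variable {X : Type} [TopologicalSpace X] [ChartedSpace E3 X] [IsManifold (𝓡 3) ∞ X]
  (e : AFEnd X) (D : InitialDataSet (𝓡 3) X)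

/-- The derivatives of the quadratic function `q_u(z) = ‖z‖² − ⟨u, z⟩²`:
`Dq_u(y) = 2⟨y, ·⟩ − 2⟨u, y⟩⟨u, ·⟩` and `D²q_u(y)(X, Y) = 2⟨X, Y⟩ − 2⟨u, X⟩⟨u, Y⟩`. [folklore] -/
theorem fderiv_cylSq (u y : E3) :
    fderiv ℝ (fun z : E3 ↦ ‖z‖ ^ 2 - ⟪u, z⟫ ^ 2) y =
        (2 : ℝ) • (innerSL ℝ y : E3 →L[ℝ] ℝ) - (2 * ⟪u, y⟫) • (innerSL ℝ u : E3 →L[ℝ] ℝ) ∧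
      fderiv ℝ (fderiv ℝ (fun z : E3 ↦ ‖z‖ ^ 2 - ⟪u, z⟫ ^ 2)) y =
        (2 : ℝ) • (innerSL ℝ : E3 →L[ℝ] E3 →L[ℝ] ℝ) -
          ((2 : ℝ) • (innerSL ℝ u : E3 →L[ℝ] ℝ)).smulRight (innerSL ℝ u : E3 →L[ℝ] ℝ) := by
  set L : E3 →L[ℝ] ℝ := innerSL ℝ u with hL
  have hLa : ∀ z, L z = ⟪u, z⟫ := fun z ↦ rfl
  -- first derivatives, at every point
  have hn : ∀ z : E3, HasFDerivAt (fun x : E3 ↦ ‖x‖ ^ 2) ((2 : ℝ) • (innerSL ℝ z : E3 →L[ℝ] ℝ)) z :=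
    fun z ↦ by
      have h := (hasStrictFDerivAt_norm_sq z).hasFDerivAt
      rwa [← Nat.cast_smul_eq_nsmul ℝ, Nat.cast_ofNat] at h
  have hg : ∀ z : E3, HasFDerivAt (fun x : E3 ↦ ⟪u, x⟫ ^ 2) ((2 * ⟪u, z⟫) • L) z := fun z ↦ by
    have h := (L.hasFDerivAt (x := z)).mul (L.hasFDerivAt (x := z))
    have h' : HasFDerivAt (fun x : E3 ↦ ⟪u, x⟫ ^ 2) (L z • L + L z • L) z := by
      refine h.congr_of_eventuallyEq (Filter.Eventually.of_forall fun x ↦ ?_)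
      simp only [Pi.mul_apply, hLa, sq]
    convert h' using 1
    rw [hLa, ← add_smul]; ring_nf
  have hf : ∀ z : E3, HasFDerivAt (fun x : E3 ↦ ‖x‖ ^ 2 - ⟪u, x⟫ ^ 2)
      ((2 : ℝ) • (innerSL ℝ z : E3 →L[ℝ] ℝ) - (2 * ⟪u, z⟫) • L) z := fun z ↦ (hn z).sub (hg z)
  have hf' : fderiv ℝ (fun x : E3 ↦ ‖x‖ ^ 2 - ⟪u, x⟫ ^ 2) =
      fun z ↦ (2 : ℝ) • (innerSL ℝ z : E3 →L[ℝ] ℝ) - (2 * ⟪u, z⟫) • L :=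
    funext fun z ↦ (hf z).fderiv
  refine ⟨(hf y).fderiv, ?_⟩
  rw [hf']
  -- second derivative
  have h1 : HasFDerivAt (fun z : E3 ↦ (2 : ℝ) • (innerSL ℝ z : E3 →L[ℝ] ℝ))
      ((2 : ℝ) • (innerSL ℝ : E3 →L[ℝ] E3 →L[ℝ] ℝ)) y :=
    ((innerSL ℝ : E3 →L[ℝ] E3 →L[ℝ] ℝ).hasFDerivAt).const_smul (2 : ℝ)
  have hc : HasFDerivAt (fun z : E3 ↦ 2 * ⟪u, z⟫) ((2 : ℝ) • L) y := by
    have h := (L.hasFDerivAt (x := y)).const_mul (2 : ℝ)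
    refine h.congr_of_eventuallyEq (Filter.Eventually.of_forall fun x ↦ ?_)
    simp only [hLa]
  have h2 : HasFDerivAt (fun z : E3 ↦ (2 * ⟪u, z⟫) • L) (((2 : ℝ) • L).smulRight L) y :=
    hc.smul_const L
  exact (h1.sub h2).fderiv

set_option maxHeartbeats 800000 in
/-- **Schoen–Yau 1979, p. 58: the Hessian of `(r')²` far out**, chart form. For
`G = hCoeff e D` with `IsAsymptoticallySchwarzschild e D M 2` there is `C ≥ 0` with, eventually
along `cobounded E3`, for all `u` with `‖u‖ ≤ 1` and all `X`,
`|Hess_G (|y|² − ⟨u,y⟩²)(X, X) − (2‖X‖² − 2⟨u, X⟩²)| ≤ C |y|⁻¹ ‖X‖²`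
(printed: "`D_{eᵢeᵢ}(r')² = 2 Σ_{j≤2} ⟨eᵢ, ∂ⱼ⟩² + O(1/r)`"): the difference is the Christoffel
term `Dq(Γ(X,X))` with `‖Dq‖ ≤ 4|y|` and `‖Γ(X,X)‖ ≤ (3/2)‖♯‖‖DG‖‖X‖²`, `‖DG‖ = O(r⁻²)`.
[cite: SchoenYauPMT1979, §2, second proof of the Claim, p. 58] -/
theorem eventually_abs_hessAt_hCoeff_cylSq_sub_le {M : ℝ}
    (hAS : IsAsymptoticallySchwarzschild e D M 2) :
    ∃ C : ℝ, 0 ≤ C ∧ ∀ᶠ y in cobounded E3, ∀ u X : E3, ‖u‖ ≤ 1 →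
      |hessAt (hCoeff e D) (fun z : E3 ↦ ‖z‖ ^ 2 - ⟪u, z⟫ ^ 2) y X X
          - (2 * ‖X‖ ^ 2 - 2 * ⟪u, X⟫ ^ 2)| ≤ C * ‖y‖⁻¹ * ‖X‖ ^ 2 := by
  -- notation
  set δ : E3 →L[ℝ] E3 →L[ℝ] ℝ := (innerSL ℝ : E3 →L[ℝ] E3 →L[ℝ] ℝ) with hδdef
  have hδ : ∀ v w : E3, δ v w = ⟪v, w⟫ := fun v w ↦ rfl
  set G : E3 → E3 →L[ℝ] E3 →L[ℝ] ℝ := hCoeff e D with hGdef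
  set w : E3 → ℝ := fun y ↦ 1 + M / (2 * ‖y‖) with hwdef
  set G₀ : E3 → E3 →L[ℝ] E3 →L[ℝ] ℝ := fun y ↦ w y ^ 4 • δ with hG₀def
  -- (1.1): `G - G₀ = O(r⁻²)`, `∂(G - G₀) = O(r⁻³)`
  have hO0 := hAS 0 (by norm_num)
  have hO1 := hAS 1 (by norm_num)
  simp only [Nat.cast_zero, sub_zero, Nat.cast_one] at hO0 hO1
  have hO0' : (fun x ↦ ‖G x - G₀ x‖) =O[cobounded E3] fun x ↦ ‖x‖ ^ (-(2 : ℕ) : ℝ) := by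
    refine (hO0.congr_left fun x ↦ ?_).congr_right fun x ↦ by norm_num
    rw [norm_iteratedFDeriv_zero]
  have hO1' : (fun x ↦ ‖fderiv ℝ (fun y ↦ G y - G₀ y) x‖) =O[cobounded E3]
      fun x ↦ ‖x‖ ^ (-(3 : ℕ) : ℝ) := by
    refine (hO1.congr_left fun x ↦ ?_).congr_right fun x ↦ by norm_num
    rw [norm_iteratedFDeriv_one]
  obtain ⟨C₁, hC₁, hev1⟩ := exists_pos_eventually_le_of_isBigO (fun x ↦ norm_nonneg _) hO1'
  have htend : Tendsto (fun x ↦ ‖G x - G₀ x‖) (cobounded E3) (𝓝 0) := by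
    refine hO0'.trans_tendsto ?_
    have h := (tendsto_rpow_neg_atTop (by norm_num : (0 : ℝ) < 2)).comp
      (tendsto_norm_cobounded_atTop (E := E3))
    refine h.congr fun x ↦ ?_
    simp only [Function.comp_apply, Nat.cast_ofNat]
  have hev_small : ∀ᶠ x in cobounded E3, ‖G x - G₀ x‖ ≤ 16⁻¹ :=
    (htend.eventually (ge_mem_nhds (by norm_num : (0 : ℝ) < 16⁻¹)))
  set K : ℝ := 3 * |M| + C₁ with hKdef
  have hKpos : 0 < K := by positivity
  refine ⟨12 * K, by positivity, ?_⟩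
  filter_upwards [hev1, hev_small, eventually_cobounded_lt_norm (E := E3) e.R,
    eventually_cobounded_le_norm (E := E3) (max 1 (4 * |M|))]
    with y hy1 hysmall hyR hybig u X hu
  have hy1' : 1 ≤ ‖y‖ := le_trans (le_max_left _ _) hybig
  have hyM : 4 * |M| ≤ ‖y‖ := le_trans (le_max_right _ _) hybig
  have hypos : 0 < ‖y‖ := by linarith
  have hy_ne : y ≠ 0 := norm_pos_iff.1 hypos
  -- `w` between `7/8` and `9/8`
  have hw_ge : 7 / 8 ≤ w y := by
    simp only [hwdef]
    have h1 : -|M| ≤ M := neg_abs_le M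
    have h2 : M / (2 * ‖y‖) ≥ -(8⁻¹) := by
      rw [ge_iff_le, le_div_iff₀ (by positivity)]
      linarith
    linarith
  have hw_le : w y ≤ 9 / 8 := by
    simp only [hwdef]
    have h1 : M ≤ |M| := le_abs_self M
    have h2 : M / (2 * ‖y‖) ≤ 8⁻¹ := by
      rw [div_le_iff₀ (by positivity)]
      linarith
    linarith
  have hwpos : 0 < w y := by linarith
  have hw4_ge : 58 / 100 ≤ w y ^ 4 := by
    have h := pow_le_pow_left₀ (by norm_num : (0 : ℝ) ≤ 7 / 8) hw_ge 4
    norm_num at h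
    linarith
  have hw3_le : w y ^ 3 ≤ 3 / 2 := by
    have h := pow_le_pow_left₀ hwpos.le hw_le 3
    norm_num at h
    linarith
  -- `‖DG‖ ≤ K r⁻²`
  have hGd : DifferentiableAt ℝ G y := (e.contDiffAt_hCoeff D hyR).differentiableAt (by simp)
  have hwd : HasFDerivAt w ((M / 2) • ((-(‖y‖ ^ 3)⁻¹) • (innerSL ℝ y : E3 →L[ℝ] ℝ))) y := by
    have h := ((hasFDerivAt_inv_norm hy_ne).const_mul (M / 2)).const_add 1
    refine h.congr_of_eventuallyEq (Filter.Eventually.of_forall fun z ↦ ?_)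
    simp only [hwdef, div_eq_mul_inv, mul_inv]
    ring
  have hw4d := hwd.pow 4
  have hDw4 : ‖fderiv ℝ (fun z : E3 ↦ w z ^ 4) y‖ ≤ 3 * |M| * (‖y‖ ^ 2)⁻¹ := by
    rw [hw4d.fderiv]
    have h0 : (4 • w y ^ (4 - 1) : ℝ) = 4 * w y ^ 3 := by norm_num [nsmul_eq_mul]
    rw [h0, norm_smul, norm_smul, norm_smul, Real.norm_eq_abs, Real.norm_eq_abs,
      Real.norm_eq_abs, abs_neg, abs_inv, abs_of_pos (pow_pos hypos 3), innerSL_apply_norm]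
    have h1 : |4 * w y ^ 3| ≤ 6 := by
      rw [abs_of_nonneg (by positivity)]
      linarith
    have h2 : |M / 2| = |M| / 2 := by rw [abs_div, abs_two]
    rw [h2]
    have h3 : (‖y‖ ^ 3)⁻¹ * ‖y‖ = (‖y‖ ^ 2)⁻¹ := by field_simp
    calc |4 * w y ^ 3| * (|M| / 2 * ((‖y‖ ^ 3)⁻¹ * ‖y‖))
        ≤ 6 * (|M| / 2 * ((‖y‖ ^ 3)⁻¹ * ‖y‖)) := by gcongr
      _ = 3 * |M| * (‖y‖ ^ 2)⁻¹ := by rw [h3]; ring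
  obtain ⟨hG₀d, hG₀n⟩ := differentiableAt_smul_const_norm_le hw4d.differentiableAt δ
  have hDG₀ : ‖fderiv ℝ G₀ y‖ ≤ 3 * |M| * (‖y‖ ^ 2)⁻¹ := by
    calc ‖fderiv ℝ G₀ y‖ ≤ ‖fderiv ℝ (fun z : E3 ↦ w z ^ 4) y‖ * ‖δ‖ := hG₀n
      _ ≤ ‖fderiv ℝ (fun z : E3 ↦ w z ^ 4) y‖ * 1 := by
          gcongr; exact norm_innerSL_bilin_le_one
      _ ≤ 3 * |M| * (‖y‖ ^ 2)⁻¹ := by rw [mul_one]; exact hDw4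
  have hsplit : fderiv ℝ (fun z ↦ G z - G₀ z) y = fderiv ℝ G y - fderiv ℝ G₀ y :=
    fderiv_fun_sub hGd hG₀d
  rw [hsplit] at hy1
  have hr32 : (‖y‖ ^ 3)⁻¹ ≤ (‖y‖ ^ 2)⁻¹ :=
    inv_anti₀ (by positivity) (pow_le_pow_right₀ hy1' (by norm_num))
  have hDG : ‖fderiv ℝ G y‖ ≤ K * (‖y‖ ^ 2)⁻¹ := by
    have h : ‖fderiv ℝ G y‖ ≤ ‖fderiv ℝ G₀ y‖ + ‖fderiv ℝ G y - fderiv ℝ G₀ y‖ := by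
      have := norm_add_le (fderiv ℝ G₀ y) (fderiv ℝ G y - fderiv ℝ G₀ y)
      rwa [add_sub_cancel] at this
    have h' : ‖fderiv ℝ G y - fderiv ℝ G₀ y‖ ≤ C₁ * (‖y‖ ^ 2)⁻¹ :=
      hy1.trans (mul_le_mul_of_nonneg_left hr32 hC₁.le)
    rw [hKdef]
    linarith
  -- coercivity and `‖♯‖ ≤ 2`
  have hcoer : ∀ v : E3, 2⁻¹ * ‖v‖ ^ 2 ≤ G y v v := fun v ↦ by
    have h1 : G y v v = G₀ y v v + (G y - G₀ y) v v := by
      simp only [_root_.sub_apply]; ring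
    have h2 : G₀ y v v = w y ^ 4 * ‖v‖ ^ 2 := by
      rw [hG₀def, smul_clm_apply₂, hδ, real_inner_self_eq_norm_sq]
    have h3 : |(G y - G₀ y) v v| ≤ 16⁻¹ * ‖v‖ ^ 2 := by
      calc |(G y - G₀ y) v v| ≤ ‖(G y - G₀ y) v‖ * ‖v‖ := by
            rw [← Real.norm_eq_abs]; exact le_opNorm _ _
        _ ≤ ‖G y - G₀ y‖ * ‖v‖ * ‖v‖ := by gcongr; exact le_opNorm _ _
        _ ≤ 16⁻¹ * ‖v‖ * ‖v‖ := by gcongr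
        _ = 16⁻¹ * ‖v‖ ^ 2 := by ring
    have h4 := neg_abs_le ((G y - G₀ y) v v)
    have h5 := mul_le_mul_of_nonneg_right hw4_ge (sq_nonneg ‖v‖)
    rw [h1, h2]
    linarith [sq_nonneg ‖v‖]
  have hinv : (G y).IsInvertible := isInvertible_of_nondegenerate fun v hv ↦ by
    have h := hcoer v
    rw [hv v] at h
    have : ‖v‖ ^ 2 ≤ 0 := by linarith
    exact norm_eq_zero.1 (pow_eq_zero_iff two_ne_zero |>.1 (le_antisymm this (sq_nonneg _)))
  have hS : ‖sharpAt G y‖ ≤ 2 := by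
    have := norm_sharpAt_le_of_coercive hinv (by norm_num : (0 : ℝ) < 2⁻¹) hcoer
    norm_num at this
    exact this
  -- the derivatives of `q = |y|² − ⟨u, y⟩²`
  set f : E3 → ℝ := fun z ↦ ‖z‖ ^ 2 - ⟪u, z⟫ ^ 2 with hfdef
  obtain ⟨hDf, hD2f⟩ := fderiv_cylSq u y
  have hDfn : ‖fderiv ℝ f y‖ ≤ 4 * ‖y‖ := by
    rw [hDf]
    refine (norm_sub_le _ _).trans ?_
    rw [norm_smul, norm_smul, Real.norm_eq_abs, Real.norm_eq_abs, abs_two, innerSL_apply_norm,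
      innerSL_apply_norm, abs_mul, abs_two]
    have h1 : |⟪u, y⟫| ≤ ‖u‖ * ‖y‖ := abs_real_inner_le_norm _ _
    have h2 : 2 * |⟪u, y⟫| * ‖u‖ ≤ 2 * ‖y‖ := by
      have h3 : |⟪u, y⟫| * ‖u‖ ≤ (‖u‖ * ‖y‖) * 1 :=
        mul_le_mul h1 hu (norm_nonneg _) (by positivity)
      have h4 : ‖u‖ * ‖y‖ ≤ 1 * ‖y‖ := mul_le_mul_of_nonneg_right hu (norm_nonneg _)
      linarith
    linarith
  -- the Christoffel term
  have hΓ : |fderiv ℝ f y (chrAt G y X X)| ≤ 12 * K * ‖y‖⁻¹ * ‖X‖ ^ 2 := by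
    have h1 : |fderiv ℝ f y (chrAt G y X X)| ≤ ‖fderiv ℝ f y‖ * ‖chrAt G y X X‖ := by
      rw [← Real.norm_eq_abs]; exact le_opNorm _ _
    have h3 : ‖chrAt G y X X‖ ≤ 2⁻¹ * (‖sharpAt G y‖ * (3 * ‖fderiv ℝ G y‖ * ‖X‖)) * ‖X‖ :=
      (le_opNorm _ _).trans (mul_le_mul_of_nonneg_right (norm_chrAt_apply_le X) (norm_nonneg _))
    have h4 : 2⁻¹ * (‖sharpAt G y‖ * (3 * ‖fderiv ℝ G y‖ * ‖X‖)) * ‖X‖ ≤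
        2⁻¹ * (2 * (3 * (K * (‖y‖ ^ 2)⁻¹) * ‖X‖)) * ‖X‖ := by gcongr
    have h5 : 4 * ‖y‖ * (2⁻¹ * (2 * (3 * (K * (‖y‖ ^ 2)⁻¹) * ‖X‖)) * ‖X‖) =
        12 * K * ‖y‖⁻¹ * ‖X‖ ^ 2 := by
      field_simp
      ring
    calc |fderiv ℝ f y (chrAt G y X X)| ≤ ‖fderiv ℝ f y‖ * ‖chrAt G y X X‖ := h1
      _ ≤ (4 * ‖y‖) * (2⁻¹ * (2 * (3 * (K * (‖y‖ ^ 2)⁻¹) * ‖X‖)) * ‖X‖) :=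
          mul_le_mul hDfn (h3.trans h4) (norm_nonneg _) (by positivity)
      _ = 12 * K * ‖y‖⁻¹ * ‖X‖ ^ 2 := h5
  -- conclusion
  rw [hessAt_apply, hD2f]
  have hmain : ((2 : ℝ) • (innerSL ℝ : E3 →L[ℝ] E3 →L[ℝ] ℝ) -
      ((2 : ℝ) • (innerSL ℝ u : E3 →L[ℝ] ℝ)).smulRight (innerSL ℝ u : E3 →L[ℝ] ℝ)) X X =
      2 * ‖X‖ ^ 2 - 2 * ⟪u, X⟫ ^ 2 := by
    rw [_root_.sub_apply, _root_.sub_apply, smul_clm_apply₂, innerSL_apply_apply,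
      real_inner_self_eq_norm_sq, ContinuousLinearMap.smulRight_apply, _root_.smul_apply,
      _root_.smul_apply, innerSL_apply_apply, smul_eq_mul, smul_eq_mul]
    ring
  rw [hmain]
  have hring : 2 * ‖X‖ ^ 2 - 2 * ⟪u, X⟫ ^ 2 - fderiv ℝ f y (chrAt G y X X) -
      (2 * ‖X‖ ^ 2 - 2 * ⟪u, X⟫ ^ 2) = -(fderiv ℝ f y (chrAt G y X X)) := by ring
  rw [hring, abs_neg]
  exact hΓ

/-- Radius form of `eventually_abs_hessAt_hCoeff_cylSq_sub_le`, together with the smallness of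
`G − δ`: beyond `ρ₁ ≥ R`, `|Hess_G q_u (X,X) − (2‖X‖² − 2⟨u,X⟩²)| ≤ C|y|⁻¹‖X‖²` and
`‖G(y) − δ‖ ≤ C'|y|⁻¹`. [cite: SchoenYauPMT1979, §2, p. 58] -/
theorem exists_radius_hessAt_cylSq {M : ℝ} (hAS : IsAsymptoticallySchwarzschild e D M 2) :
    ∃ C C' ρ₁ : ℝ, 0 ≤ C ∧ 0 ≤ C' ∧ e.R ≤ ρ₁ ∧ 1 ≤ ρ₁ ∧ ∀ y : E3, ρ₁ ≤ ‖y‖ →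
      (∀ u X : E3, ‖u‖ ≤ 1 →
        |hessAt (hCoeff e D) (fun z : E3 ↦ ‖z‖ ^ 2 - ⟪u, z⟫ ^ 2) y X X
            - (2 * ‖X‖ ^ 2 - 2 * ⟪u, X⟫ ^ 2)| ≤ C * ‖y‖⁻¹ * ‖X‖ ^ 2) ∧
      ‖hCoeff e D y - (innerSL ℝ : E3 →L[ℝ] E3 →L[ℝ] ℝ)‖ ≤ C' * ‖y‖⁻¹ := by
  obtain ⟨C, hC, hev⟩ := e.eventually_abs_hessAt_hCoeff_cylSq_sub_le D hAS
  -- `‖G − δ‖ ≤ ‖G − G₀‖ + |w⁴ − 1| ≤ C₀ r⁻² + 3|M| r⁻¹`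
  set δ : E3 →L[ℝ] E3 →L[ℝ] ℝ := (innerSL ℝ : E3 →L[ℝ] E3 →L[ℝ] ℝ) with hδdef
  have hO0 := hAS 0 (by norm_num)
  simp only [Nat.cast_zero, sub_zero] at hO0
  have hO0' : (fun x ↦ ‖hCoeff e D x - (1 + M / (2 * ‖x‖)) ^ 4 • δ‖) =O[cobounded E3]
      fun x ↦ ‖x‖ ^ (-(2 : ℕ) : ℝ) := by
    refine (hO0.congr_left fun x ↦ ?_).congr_right fun x ↦ by norm_num
    rw [norm_iteratedFDeriv_zero]
  obtain ⟨C₀, hC₀, hev0⟩ := exists_pos_eventually_le_of_isBigO (fun x ↦ norm_nonneg _) hO0'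
  have hev' : ∀ᶠ y in cobounded E3, ‖hCoeff e D y - δ‖ ≤ (C₀ + 3 * |M|) * ‖y‖⁻¹ := by
    filter_upwards [hev0, eventually_cobounded_le_norm (E := E3) (max 1 (4 * |M|))]
      with y hy0 hybig
    have hy1' : 1 ≤ ‖y‖ := le_trans (le_max_left _ _) hybig
    have hyM : 4 * |M| ≤ ‖y‖ := le_trans (le_max_right _ _) hybig
    have hypos : 0 < ‖y‖ := by linarith
    set w : ℝ := 1 + M / (2 * ‖y‖) with hw
    have ht : |M / (2 * ‖y‖)| ≤ 8⁻¹ := by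
      rw [abs_div, abs_of_pos (by positivity : (0 : ℝ) < 2 * ‖y‖), div_le_iff₀ (by positivity)]
      linarith
    have hw_le : |w| ≤ 9 / 8 := by
      have := abs_add_le (1 : ℝ) (M / (2 * ‖y‖))
      rw [abs_one] at this
      simp only [hw]; linarith
    have hw4 : |w ^ 4 - 1| ≤ 3 * |M| * ‖y‖⁻¹ := by
      have hfac : w ^ 4 - 1 = (w - 1) * (w ^ 3 + w ^ 2 + w + 1) := by ring
      have hw1 : |w - 1| = |M| / (2 * ‖y‖) := by
        simp only [hw, add_sub_cancel_left, abs_div, abs_of_pos (by positivity : (0:ℝ) < 2 * ‖y‖)]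
      have hpoly : |w ^ 3 + w ^ 2 + w + 1| ≤ 6 := by
        have hle : |w ^ 3 + w ^ 2 + w + 1| ≤ |w| ^ 3 + |w| ^ 2 + |w| + 1 := by
          calc |w ^ 3 + w ^ 2 + w + 1| ≤ |w ^ 3 + w ^ 2 + w| + |(1 : ℝ)| := abs_add_le _ _
            _ ≤ (|w ^ 3 + w ^ 2| + |w|) + 1 := by
                rw [abs_one]; gcongr; exact abs_add_le _ _
            _ ≤ (|w ^ 3| + |w ^ 2| + |w|) + 1 := by gcongr; exact abs_add_le _ _
            _ = |w| ^ 3 + |w| ^ 2 + |w| + 1 := by rw [abs_pow, abs_pow]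
        have ha := abs_nonneg w
        have hp3 : |w| ^ 3 ≤ (9 / 8 : ℝ) ^ 3 := pow_le_pow_left₀ ha hw_le 3
        have hp2 : |w| ^ 2 ≤ (9 / 8 : ℝ) ^ 2 := pow_le_pow_left₀ ha hw_le 2
        norm_num at hp3 hp2
        have hp2' : |w| ^ 2 ≤ 81 / 64 := by rw [sq_abs]; exact hp2
        linarith
      rw [hfac, abs_mul, hw1]
      calc |M| / (2 * ‖y‖) * |w ^ 3 + w ^ 2 + w + 1| ≤ |M| / (2 * ‖y‖) * 6 := by gcongr
        _ = 3 * |M| * ‖y‖⁻¹ := by field_simp; ring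
    have hsplit : hCoeff e D y - δ = (hCoeff e D y - w ^ 4 • δ) + (w ^ 4 - 1) • δ := by
      rw [sub_smul, one_smul]; abel
    rw [hsplit]
    refine (norm_add_le _ _).trans ?_
    have h1 : ‖hCoeff e D y - w ^ 4 • δ‖ ≤ C₀ * ‖y‖⁻¹ := by
      refine hy0.trans ?_
      have : (‖y‖ ^ 2)⁻¹ ≤ ‖y‖⁻¹ := by
        rw [← pow_one ‖y‖⁻¹, ← inv_pow]
        exact pow_le_pow_of_le_one (by positivity) (inv_le_one_of_one_le₀ hy1') (by norm_num)
      exact mul_le_mul_of_nonneg_left this hC₀.le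
    have h2 : ‖(w ^ 4 - 1) • δ‖ ≤ 3 * |M| * ‖y‖⁻¹ := by
      rw [norm_smul, Real.norm_eq_abs]
      calc |w ^ 4 - 1| * ‖δ‖ ≤ 3 * |M| * ‖y‖⁻¹ * 1 :=
            mul_le_mul hw4 norm_innerSL_bilin_le_one (norm_nonneg _) (by positivity)
        _ = 3 * |M| * ‖y‖⁻¹ := mul_one _
    linarith
  obtain ⟨σ₀, hσ₀⟩ := exists_radius_of_eventually (hev.and hev')
  refine ⟨C, C₀ + 3 * |M|, max (max σ₀ e.R) 1, hC, by positivity,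
    (le_max_right _ _).trans (le_max_left _ _), le_max_right _ _, fun y hy ↦ ?_⟩
  have h := hσ₀ y (((le_max_left _ _).trans (le_max_left _ _)).trans hy)
  exact ⟨fun u X hu ↦ h.1 u X hu, h.2⟩

variable [D.metric.HasLeviCivita]

omit [IsManifold (𝓡 3) ∞ X] [D.metric.HasLeviCivita] in
/-- The function `|coord|² − ⟨u, coord⟩²` is smooth at the points of the end. [folklore] -/
theorem contMDiffAt_cylSq_coord (u : E3) {q : X} (hq : q ∈ e.U) :
    ContMDiffAt (𝓡 3) 𝓘(ℝ, ℝ) ∞ (fun p ↦ ‖e.coord p‖ ^ 2 - ⟪u, e.coord p⟫ ^ 2) q :=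
  ((contDiff_norm_sq ℝ (n := ∞)).sub
    ((innerSL ℝ u : E3 →L[ℝ] ℝ).contDiff.pow 2)).comp_contMDiffAt (e.contMDiffAt_coord hq)

omit [D.metric.HasLeviCivita] in
/-- The chart components evaluate the metric on chart directions, bilinear form:
`G(z)(X, Y) = h(dΦ X, dΦ Y)`. [cite: Bartnik1986, (1.3)] -/
theorem hCoeff_apply₂_eq_metric_dataChart (z : exteriorRegion e.R) (X₀ Y₀ : E3) :
    hCoeff e D (z : E3) X₀ Y₀ = D.metric.val (e.dataChart z)
      (mfderiv (𝓡 3) (𝓡 3) e.dataChart z X₀) (mfderiv (𝓡 3) (𝓡 3) e.dataChart z Y₀) := by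
  rw [e.hCoeff_coe D z]
  rfl

set_option maxHeartbeats 800000 in
/-- **The Hessian of `(r')²` on an orthonormal `2`-frame far out is positive.** Let the radius
`ρ₁` and constants `C, C'` be as in `exists_radius_hessAt_cylSq`, `q` a point of the end with
`‖coord q‖ ≥ max ρ₁ (64 (C' + 1) + 48 (C + 1))`, `u` a unit vector and `w₁, w₂ ∈ T_q X`
orthonormal for `h`. Then `Hess_h q_u (w₁, w₁) + Hess_h q_u (w₂, w₂) > 0` for
`q_u = |coord|² − ⟨u, coord⟩²` — Schoen–Yau's "`Σᵢ D_{eᵢeᵢ}(r')² ≥ 2 − O(1/r)`": with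
`Xₐ = dcoord(wₐ)`, `G(Xₐ, X_b) = δ_{ab}` makes `X₁, X₂` nearly orthonormal, the chart estimate
gives `Σₐ Hess ≥ Σₐ (2‖Xₐ‖² − 2⟨u,Xₐ⟩²) − O(1/r)`, and Bessel `Σₐ ⟨u,Xₐ⟩² ≤ 1 + O(1/r)`.
[cite: SchoenYauPMT1979, §2, second proof of the Claim, p. 58] -/
theorem hessian_cylSq_frame_pos_of_mem {C C' ρ₁ : ℝ} (hC : 0 ≤ C) (hC' : 0 ≤ C')
    (hest : ∀ y : E3, ρ₁ ≤ ‖y‖ →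
      (∀ u X : E3, ‖u‖ ≤ 1 →
        |hessAt (hCoeff e D) (fun z : E3 ↦ ‖z‖ ^ 2 - ⟪u, z⟫ ^ 2) y X X
            - (2 * ‖X‖ ^ 2 - 2 * ⟪u, X⟫ ^ 2)| ≤ C * ‖y‖⁻¹ * ‖X‖ ^ 2) ∧
      ‖hCoeff e D y - (innerSL ℝ : E3 →L[ℝ] E3 →L[ℝ] ℝ)‖ ≤ C' * ‖y‖⁻¹)
    {q : X} (hqU : q ∈ e.U) (hρq : ρ₁ ≤ ‖e.coord q‖)
    (hbig : 64 * (C' + 1) + 48 * (C + 1) ≤ ‖e.coord q‖) {u : E3} (hu : ‖u‖ = 1)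
    {w₁ w₂ : TangentSpace (𝓡 3) q} (h₁ : D.metric.val q w₁ w₁ = 1) (h₂ : D.metric.val q w₂ w₂ = 1)
    (h₁₂ : D.metric.val q w₁ w₂ = 0) :
    0 < D.metric.hessian (fun p ↦ ‖e.coord p‖ ^ 2 - ⟪u, e.coord p⟫ ^ 2) q w₁ w₁ +
      D.metric.hessian (fun p ↦ ‖e.coord p‖ ^ 2 - ⟪u, e.coord p⟫ ^ 2) q w₂ w₂ := by
  -- write `q = Φ z`, `wₐ = dΦ Xₐ`
  have hfar : q ∈ e.far e.R := e.mem_far_iff_coord.2 ⟨hqU, e.lt_norm_coord hqU⟩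
  obtain ⟨z, -, rfl⟩ := e.mem_far_iff.1 hfar
  obtain ⟨X₁, rfl⟩ := e.exists_mfderiv_dataChart_eq z w₁
  obtain ⟨X₂, rfl⟩ := e.exists_mfderiv_dataChart_eq z w₂
  rw [e.coord_dataChart z] at hρq hbig
  rw [← e.hCoeff_apply₂_eq_metric_dataChart D z] at h₁ h₂ h₁₂
  have hzU : e.dataChart z ∈ e.U := (e.chart.symm z).2
  have hφ : ContMDiffAt (𝓡 3) 𝓘(ℝ, ℝ) 2 (fun p ↦ ‖e.coord p‖ ^ 2 - ⟪u, e.coord p⟫ ^ 2)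
      (e.dataChart z) :=
    (e.contMDiffAt_cylSq_coord u hzU).of_le (WithTop.coe_le_coe.mpr le_top)
  have hrepr : ∀ y : exteriorRegion e.R,
      (fun p ↦ ‖e.coord p‖ ^ 2 - ⟪u, e.coord p⟫ ^ 2) (e.dataChart y) =
        (fun v : E3 ↦ ‖v‖ ^ 2 - ⟪u, v⟫ ^ 2) y := fun y ↦ by
    simp only [e.coord_dataChart]
  have hΦr : ContDiffAt ℝ 2 (fun v : E3 ↦ ‖v‖ ^ 2 - ⟪u, v⟫ ^ 2) z :=
    ((contDiff_norm_sq ℝ (n := 2)).sub ((innerSL ℝ u : E3 →L[ℝ] ℝ).contDiff.pow 2)).contDiffAt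
  rw [e.hessian_dataChart_apply_eq_hessAt D z hφ hrepr hΦr X₁ X₁,
    e.hessian_dataChart_apply_eq_hessAt D z hφ hrepr hΦr X₂ X₂]
  -- the quantitative data at `z`
  set r : ℝ := ‖(z : E3)‖ with hr
  have hrpos : 0 < r := by rw [hr]; linarith
  obtain ⟨hH, hGδ⟩ := hest z hρq
  set η : ℝ := C' * r⁻¹ with hη
  have hη0 : 0 ≤ η := by positivity
  have hηs : η ≤ 64⁻¹ := by
    rw [hη, mul_inv_le_iff₀ hrpos]
    nlinarith
  set ε : ℝ := C * r⁻¹ with hε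
  have hε0 : 0 ≤ ε := by positivity
  have hεs : ε ≤ 48⁻¹ := by
    rw [hε, mul_inv_le_iff₀ hrpos]
    nlinarith
  -- near-orthonormality of `X₁, X₂`
  set G := hCoeff e D (z : E3) with hG
  have hdev : ∀ V W : E3, |⟪V, W⟫ - G V W| ≤ η * ‖V‖ * ‖W‖ := fun V W ↦ by
    have h1 : ⟪V, W⟫ - G V W = -((G - (innerSL ℝ : E3 →L[ℝ] E3 →L[ℝ] ℝ)) V W) := by
      rw [_root_.sub_apply, _root_.sub_apply]
      change ⟪V, W⟫ - G V W = -(G V W - ⟪V, W⟫)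
      ring
    rw [h1, abs_neg]
    calc |(G - (innerSL ℝ : E3 →L[ℝ] E3 →L[ℝ] ℝ)) V W|
        ≤ ‖(G - (innerSL ℝ : E3 →L[ℝ] E3 →L[ℝ] ℝ)) V‖ * ‖W‖ := by
          rw [← Real.norm_eq_abs]; exact le_opNorm _ _
      _ ≤ ‖G - (innerSL ℝ : E3 →L[ℝ] E3 →L[ℝ] ℝ)‖ * ‖V‖ * ‖W‖ := by
          gcongr; exact le_opNorm _ _
      _ ≤ η * ‖V‖ * ‖W‖ := by gcongr
  have hnorm : ∀ V : E3, G V V = 1 → ‖V‖ ^ 2 ≤ 2 ∧ |‖V‖ ^ 2 - 1| ≤ 2 * η := fun V hV ↦ by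
    have h := hdev V V
    rw [hV, real_inner_self_eq_norm_sq] at h
    have hsq : ‖V‖ * ‖V‖ = ‖V‖ ^ 2 := (sq ‖V‖).symm
    have h' : |‖V‖ ^ 2 - 1| ≤ η * ‖V‖ ^ 2 := by rw [mul_assoc, hsq] at h; exact h
    have hup := (abs_le.1 h').2
    have h2 : ‖V‖ ^ 2 ≤ 2 := by nlinarith [sq_nonneg ‖V‖]
    exact ⟨h2, h'.trans (by nlinarith)⟩
  obtain ⟨hX₁b, hX₁1⟩ := hnorm X₁ h₁
  obtain ⟨hX₂b, hX₂1⟩ := hnorm X₂ h₂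
  have hX₁₂ : |⟪X₁, X₂⟫| ≤ 2 * η := by
    have h := hdev X₁ X₂
    rw [h₁₂, sub_zero] at h
    have hprod : ‖X₁‖ * ‖X₂‖ ≤ 2 := by nlinarith [norm_nonneg X₁, norm_nonneg X₂, sq_nonneg (‖X₁‖ - ‖X₂‖)]
    calc |⟪X₁, X₂⟫| ≤ η * ‖X₁‖ * ‖X₂‖ := h
      _ = η * (‖X₁‖ * ‖X₂‖) := by ring
      _ ≤ η * 2 := by gcongr
      _ = 2 * η := by ring
  -- Bessel: `Σ ⟨u, Xₐ⟩² ≤ (1 + 4η)`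
  have hB := sum_sq_inner_le_of_near_orthonormal (by positivity : (0 : ℝ) ≤ 2 * η) hX₁1 hX₂1 hX₁₂ u
  rw [hu, one_pow, mul_one] at hB
  -- the chart estimate on `X₁, X₂`
  have hu1 : ‖u‖ ≤ 1 := hu.le
  have e₁ := (abs_le.1 (hH u X₁ hu1)).1
  have e₂ := (abs_le.1 (hH u X₂ hu1)).1
  -- lower bounds `‖Xₐ‖² ≥ 1 − 2η`
  have l₁ := (abs_le.1 hX₁1).1
  have l₂ := (abs_le.1 hX₂1).1
  -- assemble: Σ ≥ 2(‖X₁‖²+‖X₂‖²) − 2(1+4η) − ε(‖X₁‖²+‖X₂‖²) ≥ 2(2−4η) − 2 − 8η − 4ε > 0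
  have hεb : C * r⁻¹ * ‖X₁‖ ^ 2 + C * r⁻¹ * ‖X₂‖ ^ 2 ≤ 4 * ε := by
    rw [← hε]; nlinarith
  nlinarith

end AFEnd

namespace SchoenYau

variable {X : Type} [TopologicalSpace X] [ChartedSpace E3 X] [IsManifold (𝓡 3) ∞ X]
  (e : AFEnd X) (D : InitialDataSet (𝓡 3) X) [D.metric.HasLeviCivita]

set_option maxHeartbeats 800000 in
/-- **Schoen–Yau 1979, p. 58: `Δ_S (r')² > 0` far out on a minimal surface.** Let `(X, h, k)` be
`3`-dimensional initial data whose end `e` has the expansion (1.1)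
(`IsAsymptoticallySchwarzschild e D M 2`, any `M`). There is `ρ₀ > 0` such that: for every surface
`S` (a `2`-manifold without boundary), every spacelike immersion `F : S → X` with a smooth unit
normal field and mean curvature `H ≡ 0`, every unit vector `u ∈ ℝ³` and every `y₀ ∈ S` with
`‖x(F y₀)‖ > ρ₀`, the restricted squared cylindrical radius
`y ↦ |x(F y)|² − ⟨u, x(F y)⟩²` (`= (r')²` for `u = e₃`) has **positive** Laplace–Beltrami
operator at `y₀` for the induced metric. Printed: "`Δ(r')² ≥ 2 − O(1/r)` … for `r` sufficiently
large … `Δ(r')² > 0`". Proof: `Δ_S(φ ∘ F) = tr_S Hess_h φ(dF·, dF·)` since `H = 0`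
(`dalembertian_comp_eq`, on a smooth cut-off version of `φ`), evaluated on an orthonormal basis
(`hessian_cylSq_frame_pos_of_mem`). [cite: SchoenYauPMT1979, §2, second proof of the Claim, p. 58] -/
theorem dalembertian_cylSq_pos {M : ℝ} (hAS : IsAsymptoticallySchwarzschild e D M 2) :
    ∃ ρ₀ : ℝ, 0 < ρ₀ ∧ ∀ (S : Type) [TopologicalSpace S]
      [ChartedSpace (EuclideanSpace ℝ (Fin 2)) S] [IsManifold (𝓡 2) ∞ S] (F : S → X)
      (hpb : PseudoRiemannianMetric.contMDiff_pullbackBilin (𝓡 3) X (𝓡 2) S ∞)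
      (hfi : D.metric.IsSpacelikeImmersion (𝓡 2) F) (ν : NormalField (𝓡 3) F),
      ContMDiff (𝓡 2) (𝓡 3).tangent ∞
          (fun y ↦ (TotalSpace.mk' E3 (F y) (ν y) : TangentBundle (𝓡 3) X)) →
      D.metric.IsUnitNormal (𝓡 2) F ν 1 →
      (∀ y, D.metric.meanCurvature F hpb hfi ν y = 0) →
      ∀ u : E3, ‖u‖ = 1 → ∀ y₀ : S, ρ₀ < ‖e.coord (F y₀)‖ →
        haveI := (D.metric.inducedMetric F hpb hfi).hasLeviCivita
        0 < (D.metric.inducedMetric F hpb hfi).dalembertian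
          (fun y ↦ ‖e.coord (F y)‖ ^ 2 - ⟪u, e.coord (F y)⟫ ^ 2) y₀ := by
  obtain ⟨C, C', ρ₁, hC, hC', hρ₁R, hρ₁1, hest⟩ := e.exists_radius_hessAt_cylSq D hAS
  set R₁ : ℝ := e.R + 1 with hR₁
  have hR₁' : e.R < R₁ := by rw [hR₁]; linarith
  have hRpos := e.R_pos
  refine ⟨max (max ρ₁ (64 * (C' + 1) + 48 * (C + 1))) (R₁ + 1),
    lt_max_of_lt_right (by rw [hR₁]; linarith), ?_⟩
  intro S _ _ _ F hpb hfi ν hν hun hmin u hu y₀ hy₀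
  -- the point `F y₀` lies far out in the end
  have hU : F y₀ ∈ e.U := by
    by_contra hcon
    rw [e.coord_of_not_mem hcon, norm_zero] at hy₀
    have : (0 : ℝ) < R₁ + 1 := by rw [hR₁]; linarith
    linarith [le_max_right (max ρ₁ (64 * (C' + 1) + 48 * (C + 1))) (R₁ + 1)]
  have hgt₁ : R₁ + 1 < ‖e.coord (F y₀)‖ := (le_max_right _ _).trans_lt hy₀
  have hρq : ρ₁ ≤ ‖e.coord (F y₀)‖ :=
    ((le_max_left _ _).trans (le_max_left _ _)).trans hy₀.le
  have hbig : 64 * (C' + 1) + 48 * (C + 1) ≤ ‖e.coord (F y₀)‖ :=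
    ((le_max_right _ _).trans (le_max_left _ _)).trans hy₀.le
  have hfar : F y₀ ∈ e.far (R₁ + 1) := e.mem_far_iff_coord.2 ⟨hU, hgt₁⟩
  -- the function and its smooth cut-off version
  set φ : X → ℝ := fun p ↦ ‖e.coord p‖ ^ 2 - ⟪u, e.coord p⟫ ^ 2 with hφdef
  set φc : X → ℝ := fun p ↦ Real.smoothTransition (‖e.coord p‖ - R₁) *
    (‖e.coord p‖ ^ 2 - ⟪u, e.coord p⟫ ^ 2) with hφcdef
  have hφc : ContMDiff (𝓡 3) 𝓘(ℝ, ℝ) ∞ φc := by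
    intro q
    by_cases hq : q ∈ ((↑) : e.U → X) '' (e.chart ⁻¹' {x | R₁ ≤ ‖(x : E3)‖})
    · obtain ⟨hqU, -⟩ := e.mem_image_preimage_le_norm_iff.1 hq
      exact ((e.contMDiff_endCutoff hR₁') q).mul (e.contMDiffAt_cylSq_coord u hqU)
    · refine (contMDiffAt_const (c := (0 : ℝ))).congr_of_eventuallyEq ?_
      filter_upwards [e.endCutoff_eventuallyEq_zero hR₁' hq] with p hp
      change Real.smoothTransition (‖e.coord p‖ - R₁) * (‖e.coord p‖ ^ 2 - ⟪u, e.coord p⟫ ^ 2)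
        = (0 : ℝ)
      rw [hp, zero_mul]
  have hloc : φc =ᶠ[𝓝 (F y₀)] fun p ↦ ‖e.coord p‖ ^ 2 - ⟪u, e.coord p⟫ ^ 2 := by
    filter_upwards [e.endCutoff_eventuallyEq_one hfar] with p hp
    change Real.smoothTransition (‖e.coord p‖ - R₁) * (‖e.coord p‖ ^ 2 - ⟪u, e.coord p⟫ ^ 2)
      = ‖e.coord p‖ ^ 2 - ⟪u, e.coord p⟫ ^ 2
    rw [hp, one_mul]
  -- the restrictions to the surface
  have hFs : ContMDiff (𝓡 2) (𝓡 3) ∞ F := hfi.contMDiff_self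
  have hcont : Tendsto F (𝓝 y₀) (𝓝 (F y₀)) := hFs.continuous.continuousAt
  have hlocS : (fun y ↦ φc (F y)) =ᶠ[𝓝 y₀]
      fun y ↦ ‖e.coord (F y)‖ ^ 2 - ⟪u, e.coord (F y)⟫ ^ 2 :=
    hcont.eventually hloc
  set γ := D.metric.inducedMetric F hpb hfi with hγ
  haveI : γ.HasLeviCivita := γ.hasLeviCivita
  have hγpos : ∀ v : TangentSpace (𝓡 2) y₀, v ≠ 0 → 0 < γ.val y₀ v v := fun v hv ↦ hfi.2 y₀ v hv
  have h2le : (2 : ℕ∞ω) ≤ ∞ := WithTop.coe_le_coe.mpr le_top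
  -- `Δ_S (φ ∘ F)(y₀) = Δ_S (φc ∘ F)(y₀) = tr_S (Hess φc ∘ (dF × dF))` since `H = 0`
  rw [← γ.dalembertian_congr_of_eventuallyEq hlocS]
  have hdim : Module.finrank ℝ E3 = Module.finrank ℝ (EuclideanSpace ℝ (Fin 2)) + 1 := by
    rw [finrank_euclideanSpace_fin, finrank_euclideanSpace_fin]
  have hΔeq := D.metric.dalembertian_comp_eq hpb hfi hν hun one_ne_zero hdim (hφc.of_le h2le) y₀
  rw [hmin y₀, mul_zero, sub_zero] at hΔeq
  rw [hΔeq]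
  -- evaluate the trace on an orthonormal basis and apply the frame estimate
  obtain ⟨b, hb⟩ := γ.exists_basis_isOrthonormalFrame (x := y₀) hγpos
    (finrank_euclideanSpace_fin (𝕜 := ℝ) (n := 2))
  rw [γ.trace_eq_sum_of_isOrthonormalFrame b hb, Fin.sum_univ_two]
  simp only [LinearMap.BilinForm.comp_apply, ContinuousLinearMap.coe_coe]
  rw [D.metric.hessian_congr_of_eventuallyEq hloc]
  have hv : ∀ i j, γ.val y₀ (b i) (b j) = D.metric.val (F y₀) (mfderiv (𝓡 2) (𝓡 3) F y₀ (b i))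
      (mfderiv (𝓡 2) (𝓡 3) F y₀ (b j)) := fun i j ↦ rfl
  have h₁ : D.metric.val (F y₀) (mfderiv (𝓡 2) (𝓡 3) F y₀ (b 0))
      (mfderiv (𝓡 2) (𝓡 3) F y₀ (b 0)) = 1 := by rw [← hv]; exact hb.1 0
  have h₂ : D.metric.val (F y₀) (mfderiv (𝓡 2) (𝓡 3) F y₀ (b 1))
      (mfderiv (𝓡 2) (𝓡 3) F y₀ (b 1)) = 1 := by rw [← hv]; exact hb.1 1
  have h₁₂ : D.metric.val (F y₀) (mfderiv (𝓡 2) (𝓡 3) F y₀ (b 0))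
      (mfderiv (𝓡 2) (𝓡 3) F y₀ (b 1)) = 0 := by rw [← hv]; exact hb.2 0 1 (by decide)
  exact e.hessian_cylSq_frame_pos_of_mem D hC hC' hest hU hρq hbig hu h₁ h₂ h₁₂

/-- **Schoen–Yau 1979, p. 58: no interior maximum of `(r')²` on a minimal surface far out** —
the use made of `Δ(r')² > 0` ("Thus `r'` takes a maximum at some point … which will give a
contradiction"): with `ρ₀` as in `dalembertian_cylSq_pos`, the restricted function
`y ↦ |x(F y)|² − ⟨u, x(F y)⟩²` has no local maximum at a point `y₀` with `‖x(F y₀)‖ > ρ₀`.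
[cite: SchoenYauPMT1979, §2, second proof of the Claim, pp. 57–58] -/
theorem not_isLocalMax_cylSq {M : ℝ} (hAS : IsAsymptoticallySchwarzschild e D M 2) :
    ∃ ρ₀ : ℝ, 0 < ρ₀ ∧ ∀ (S : Type) [TopologicalSpace S]
      [ChartedSpace (EuclideanSpace ℝ (Fin 2)) S] [IsManifold (𝓡 2) ∞ S] (F : S → X)
      (hpb : PseudoRiemannianMetric.contMDiff_pullbackBilin (𝓡 3) X (𝓡 2) S ∞)
      (hfi : D.metric.IsSpacelikeImmersion (𝓡 2) F) (ν : NormalField (𝓡 3) F),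
      ContMDiff (𝓡 2) (𝓡 3).tangent ∞
          (fun y ↦ (TotalSpace.mk' E3 (F y) (ν y) : TangentBundle (𝓡 3) X)) →
      D.metric.IsUnitNormal (𝓡 2) F ν 1 →
      (∀ y, D.metric.meanCurvature F hpb hfi ν y = 0) →
      ∀ u : E3, ‖u‖ = 1 → ∀ y₀ : S, ρ₀ < ‖e.coord (F y₀)‖ →
        ¬ IsLocalMax (fun y ↦ ‖e.coord (F y)‖ ^ 2 - ⟪u, e.coord (F y)⟫ ^ 2) y₀ := by
  obtain ⟨ρ₀, hρ₀, H⟩ := dalembertian_cylSq_pos e D hAS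
  refine ⟨ρ₀, hρ₀, fun S _ _ _ F hpb hfi ν hν hun hmin u hu y₀ hy₀ hmax ↦ ?_⟩
  have hpos := H S F hpb hfi ν hν hun hmin u hu y₀ hy₀
  -- `Δ_S ≤ 0` at the local maximum
  have hU : F y₀ ∈ e.U := by
    by_contra hcon
    rw [e.coord_of_not_mem hcon, norm_zero] at hy₀
    linarith
  set γ := D.metric.inducedMetric F hpb hfi with hγ
  haveI : γ.HasLeviCivita := γ.hasLeviCivita
  have hγpos : ∀ v : TangentSpace (𝓡 2) y₀, v ≠ 0 → 0 < γ.val y₀ v v := fun v hv ↦ hfi.2 y₀ v hv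
  have hFs : ContMDiff (𝓡 2) (𝓡 3) ∞ F := hfi.contMDiff_self
  have hψ2 : ContMDiffAt (𝓡 2) 𝓘(ℝ, ℝ) 2
      (fun y ↦ ‖e.coord (F y)‖ ^ 2 - ⟪u, e.coord (F y)⟫ ^ 2) y₀ :=
    ((e.contMDiffAt_cylSq_coord u hU).comp y₀ (hFs y₀)).of_le (WithTop.coe_le_coe.mpr le_top)
  have hle := γ.dalembertian_nonpos_of_isLocalMax hψ2 hmax hγpos
  exact absurd hle (not_le.2 hpos)

end SchoenYau

end Literature.Geometry.Lorentzian

end
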